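import Summits.KontsevichZagierPeriods.KontsevichZagierPeriods.Theorems.SoloBlindCycFlip
import HarnessLib

/-!
# Tangent-of-sum moves: weight-preserving Möbius maps in the tan-half coordinate

One-variable toolbox for the angle-polytope dissections in every dimension (sequel to
`SoloBlindCycFlip`).  In the tan-half coordinate `a = tan α` the maps

* `addT a b = (a + b)/(1 − ab)`   (`tan (α + β)`),
* `subT a b = (a − b)/(1 + ab)`   (`tan (α − β)`),
* `flipF a = (1 − a)/(1 + a)`     (`tan (π/4 − α)`, from `SoloBlindCycFlip`),
* `dblT a = 2a/(1 − a²)`          (`tan 2α`)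

are rational over `ℚ`, and the first three are ISOMETRIES of the measure `W(a) da`,
`W(a) = 2/(1 + a²)` (`tW`): `W(addT a b)·∂_b addT = W(b)`, `W(subT a b)·∂_a subT = W(a)`,
`W(flipF a)·|flipF'| = W(a)`, while the doubling doubles it: `W(dblT a)·dblT' = 2·W(a)`.
These identities are what makes every "integer-affine map of angles" a legal change of variables
(Kontsevich–Zagier rule (2)) between pieces of the angle box `[(0,1)ᵏ, ∏ W(tᵢ)]` with
`ℚ`-semialgebraic data, although the angles themselves (`2·arctan tᵢ`) are transcendental
functions of the coordinates.  The dictionary with angles is recorded through `Real.arctan`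
(`arctan_addT`, `arctan_subT`, `arctan_flipF`, `arctan_dblT`) and the basic translation
`a + b + ab < 1 ↔ arctan a + arctan b < π/4` (`add_add_mul_lt_one_iff`) used to read the tangent
cell `T = {tᵢ + tᵢ₊₁ + tᵢtᵢ₊₁ < 1}` as the angle polytope `{αᵢ + αᵢ₊₁ < π/4}`.

All statements are elementary identities/inequalities of one or two real variables; they are
used in `SoloBlindFenceChart`, `SoloBlindFenceDouble` (the min-rotation dissection of the
tangent cell in all dimensions, odd ones included).
-/

noncomputable section

open Real Set

namespace Summit.KontsevichZagierPeriods.KontsevichZagierPeriods.Theorems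

namespace SoloBlind

/-! ## The three maps -/

/-- `addT a b = (a + b)/(1 − ab)` — `tan(α + β)` for `a = tan α`, `b = tan β`. -/
def addT (a b : ℝ) : ℝ := (a + b) / (1 - a * b)

/-- `subT a b = (a − b)/(1 + ab)` — `tan(α − β)`. -/
def subT (a b : ℝ) : ℝ := (a - b) / (1 + a * b)

/-- `dblT a = 2a/(1 − a²)` — `tan 2α`. -/
def dblT (a : ℝ) : ℝ := 2 * a / (1 - a ^ 2)

/-- Unfolding `addT`. -/
theorem addT_eq (a b : ℝ) : addT a b = (a + b) / (1 - a * b) := rfl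

/-- Unfolding `subT`. -/
theorem subT_eq (a b : ℝ) : subT a b = (a - b) / (1 + a * b) := rfl

/-- Unfolding `dblT`. -/
theorem dblT_eq (a : ℝ) : dblT a = 2 * a / (1 - a ^ 2) := rfl

/-- `addT` is symmetric. -/
theorem addT_comm (a b : ℝ) : addT a b = addT b a := by
  rw [addT, addT, add_comm, mul_comm]

/-- `dblT a = addT a a`. -/
theorem dblT_eq_addT (a : ℝ) : dblT a = addT a a := by
  rw [dblT, addT, two_mul, sq]

/-! ## The dictionary with angles -/

/-- `arctan (addT a b) = arctan a + arctan b` when `ab < 1`. -/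
theorem arctan_addT {a b : ℝ} (h : a * b < 1) : arctan (addT a b) = arctan a + arctan b :=
  (arctan_add h).symm

/-- `arctan (subT a b) = arctan a − arctan b` when `ab > −1`. -/
theorem arctan_subT {a b : ℝ} (h : -1 < a * b) : arctan (subT a b) = arctan a - arctan b := by
  have h' : a * -b < 1 := by linarith
  rw [sub_eq_add_neg, ← arctan_neg, arctan_add h', subT]
  congr 1
  ring

/-- `arctan (flipF x) = π/4 − arctan x` when `x > −1`. -/
theorem arctan_flipF {x : ℝ} (h : -1 < x) : arctan (flipF x) = π / 4 - arctan x := by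
  have h' : (1 : ℝ) * -x < 1 := by linarith
  rw [← arctan_one, sub_eq_add_neg, ← arctan_neg, arctan_add h', flipF]
  congr 1
  ring

/-- `arctan (dblT a) = 2·arctan a` when `|a| < 1`. -/
theorem arctan_dblT {a : ℝ} (h1 : -1 < a) (h2 : a < 1) : arctan (dblT a) = 2 * arctan a := by
  rw [dblT, two_mul_arctan h1 h2]

/-- `arctan a < π/4 ↔ a < 1`. -/
theorem arctan_lt_pi_div_four_iff {a : ℝ} : arctan a < π / 4 ↔ a < 1 := by
  rw [← arctan_one, arctan_lt_arctan_iff]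

/-- **Dictionary**: for `a, b > 0`, `a + b + ab < 1 ↔ arctan a + arctan b < π/4`. -/
theorem add_add_mul_lt_one_iff {a b : ℝ} (ha : 0 < a) (hb : 0 < b) :
    a + b + a * b < 1 ↔ arctan a + arctan b < π / 4 := by
  by_cases hab : a * b < 1
  · rw [← arctan_addT hab, arctan_lt_pi_div_four_iff, addT, div_lt_one (by linarith)]
    constructor <;> intro h <;> linarith
  · have hab' : 1 ≤ a * b := not_lt.mp hab
    constructor
    · intro h
      nlinarith
    · intro h
      exfalso
      have h1 : a⁻¹ ≤ b := by
        rw [inv_le_iff_one_le_mul₀ ha, mul_comm]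
        exact hab'
      have h2 := arctan_mono h1
      rw [arctan_inv_of_pos ha] at h2
      linarith [arctan_pos.mpr ha, pi_pos]

/-- `addT a b ≥ 0` for `a, b ≥ 0`, `ab < 1`. -/
theorem addT_nonneg {a b : ℝ} (ha : 0 ≤ a) (hb : 0 ≤ b) (hab : a * b < 1) : 0 ≤ addT a b :=
  div_nonneg (add_nonneg ha hb) (by linarith)

/-- `addT a b > 0` for `a > 0`, `b ≥ 0`, `ab < 1`. -/
theorem addT_pos {a b : ℝ} (ha : 0 < a) (hb : 0 ≤ b) (hab : a * b < 1) : 0 < addT a b :=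
  div_pos (by linarith) (by linarith)

/-! ## Derivatives -/

/-- `∂_a subT a b = (1 + b²)/(1 + ab)²`. -/
theorem hasDerivAt_subT {a b : ℝ} (h : 1 + a * b ≠ 0) :
    HasDerivAt (fun x => subT x b) ((1 + b ^ 2) / (1 + a * b) ^ 2) a := by
  have h1 : HasDerivAt (fun x : ℝ => x - b) 1 a := (hasDerivAt_id' a).sub_const b
  have h2 : HasDerivAt (fun x : ℝ => 1 + x * b) b a := by
    simpa using ((hasDerivAt_id' a).mul_const b).const_add 1
  have h3 := h1.div h2 h
  refine h3.congr_deriv ?_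
  field_simp
  ring

/-- `∂_b addT a b = (1 + a²)/(1 − ab)²`. -/
theorem hasDerivAt_addT_right {a b : ℝ} (h : 1 - a * b ≠ 0) :
    HasDerivAt (fun x => addT a x) ((1 + a ^ 2) / (1 - a * b) ^ 2) b := by
  have h1 : HasDerivAt (fun x : ℝ => a + x) 1 b := by
    simpa using (hasDerivAt_id' b).const_add a
  have h2 : HasDerivAt (fun x : ℝ => 1 - a * x) (-a) b := by
    simpa using ((hasDerivAt_id' b).const_mul a).const_sub 1
  have h3 := h1.div h2 h
  refine h3.congr_deriv ?_
  field_simp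
  ring

/-- `∂_a addT a b = (1 + b²)/(1 − ab)²`. -/
theorem hasDerivAt_addT_left {a b : ℝ} (h : 1 - a * b ≠ 0) :
    HasDerivAt (fun x => addT x b) ((1 + b ^ 2) / (1 - a * b) ^ 2) a := by
  have h' : 1 - b * a ≠ 0 := by rwa [mul_comm]
  have := hasDerivAt_addT_right (a := b) (b := a) h'
  rw [mul_comm b a] at this
  refine (this.congr_of_eventuallyEq ?_)
  exact Filter.Eventually.of_forall fun x => addT_comm x b

/-- `dblT' a = 2(1 + a²)/(1 − a²)²`. -/
theorem hasDerivAt_dblT {a : ℝ} (h : 1 - a ^ 2 ≠ 0) :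
    HasDerivAt dblT (2 * (1 + a ^ 2) / (1 - a ^ 2) ^ 2) a := by
  have h1 : HasDerivAt (fun x : ℝ => 2 * x) 2 a := by
    simpa using (hasDerivAt_id' a).const_mul 2
  have h2 : HasDerivAt (fun x : ℝ => 1 - x ^ 2) (-(2 * a)) a := by
    simpa using (hasDerivAt_pow 2 a).const_sub 1
  have h3 := h1.div h2 h
  refine (h3.congr_of_eventuallyEq (Filter.Eventually.of_forall fun x => rfl)).congr_deriv ?_
  field_simp
  ring

/-! ## Weight identities: `addT`, `subT`, `flipF` preserve `W(a)da`; `dblT` doubles it -/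

/-- `W(subT a b)·∂_a subT = W(a)`. -/
theorem tW_subT_mul {a b : ℝ} (h : 1 + a * b ≠ 0) :
    tW (subT a b) * ((1 + b ^ 2) / (1 + a * b) ^ 2) = tW a := by
  have hd : (1 + a * b) ^ 2 + (a - b) ^ 2 ≠ 0 := by positivity
  unfold tW subT
  rw [div_pow, show (1 : ℝ) + (a - b) ^ 2 / (1 + a * b) ^ 2 =
    ((1 + a * b) ^ 2 + (a - b) ^ 2) / (1 + a * b) ^ 2 from by field_simp]
  field_simp
  ring

/-- `W(addT a b)·∂_b addT = W(b)`. -/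
theorem tW_addT_mul_right {a b : ℝ} (h : 1 - a * b ≠ 0) :
    tW (addT a b) * ((1 + a ^ 2) / (1 - a * b) ^ 2) = tW b := by
  have hd : (1 - a * b) ^ 2 + (a + b) ^ 2 ≠ 0 := by positivity
  unfold tW addT
  rw [div_pow, show (1 : ℝ) + (a + b) ^ 2 / (1 - a * b) ^ 2 =
    ((1 - a * b) ^ 2 + (a + b) ^ 2) / (1 - a * b) ^ 2 from by field_simp]
  field_simp
  ring

/-- `W(addT a b)·∂_a addT = W(a)`. -/
theorem tW_addT_mul_left {a b : ℝ} (h : 1 - a * b ≠ 0) :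
    tW (addT a b) * ((1 + b ^ 2) / (1 - a * b) ^ 2) = tW a := by
  have h' : 1 - b * a ≠ 0 := by rwa [mul_comm]
  rw [addT_comm, mul_comm a b]
  exact tW_addT_mul_right h'

/-- `W(dblT a)·dblT' = 2·W(a)`. -/
theorem tW_dblT_mul {a : ℝ} (h : 1 - a ^ 2 ≠ 0) :
    tW (dblT a) * (2 * (1 + a ^ 2) / (1 - a ^ 2) ^ 2) = 2 * tW a := by
  have hd : (1 - a ^ 2) ^ 2 + (2 * a) ^ 2 ≠ 0 := by positivity
  unfold tW dblT
  rw [div_pow, show (1 : ℝ) + (2 * a) ^ 2 / (1 - a ^ 2) ^ 2 =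
    ((1 - a ^ 2) ^ 2 + (2 * a) ^ 2) / (1 - a ^ 2) ^ 2 from by field_simp]
  field_simp
  ring

/-! ## Round trips (via the angle dictionary) -/

/-- `subT (addT b a) a = b` for `a, b ≥ 0`, `ab < 1`. -/
theorem subT_addT {a b : ℝ} (ha : 0 ≤ a) (hb : 0 ≤ b) (hab : a * b < 1) :
    subT (addT b a) a = b := by
  have hba : b * a < 1 := by rwa [mul_comm]
  have h0 : 0 ≤ addT b a := addT_nonneg hb ha hba
  apply arctan_injective
  rw [arctan_subT (by nlinarith), arctan_addT hba]
  ring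

/-- `addT (subT b a) a = b` for `0 ≤ a ≤ b`. -/
theorem addT_subT {a b : ℝ} (ha : 0 ≤ a) (hb : 0 ≤ b) (hab : a ≤ b) :
    addT (subT b a) a = b := by
  have h1 : -1 < b * a := by nlinarith
  have h2 : 0 ≤ subT b a := div_nonneg (by linarith) (by nlinarith)
  have h3 : subT b a * a < 1 := by
    rw [subT, div_mul_eq_mul_div, div_lt_one (by nlinarith)]
    nlinarith [sq_nonneg a]
  apply arctan_injective
  rw [arctan_addT h3, arctan_subT h1]
  ring

/-- `flipF` reverses order on `(-1, ∞)`. -/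
theorem flipF_lt_flipF {x y : ℝ} (hx : -1 < x) (hy : -1 < y) : flipF x < flipF y ↔ y < x := by
  rw [← arctan_lt_arctan_iff, arctan_flipF hx, arctan_flipF hy, sub_lt_sub_iff_left,
    arctan_lt_arctan_iff]

/-- `subT · b` is increasing (for positive arguments). -/
theorem subT_lt_subT_left {x y b : ℝ} (hx : 0 ≤ x) (hy : 0 ≤ y) (hb : 0 ≤ b) :
    subT x b < subT y b ↔ x < y := by
  rw [← arctan_lt_arctan_iff, arctan_subT (by nlinarith), arctan_subT (by nlinarith),
    sub_lt_sub_iff_right, arctan_lt_arctan_iff]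

end SoloBlind

end Summit.KontsevichZagierPeriods.KontsevichZagierPeriods.Theorems
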